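import Mathlib
import Literature.AlgebraicGeometry.HodgeTheory.WeilClassesFourfoldsStep2
import Literature.AlgebraicGeometry.HodgeTheory.WeilClassesSixfolds
import Literature.AlgebraicGeometry.HodgeTheory.WeilClasses
import Literature.AlgebraicGeometry.Motives.HyperbolicWeilType
import Literature.AlgebraicGeometry.Motives.AbelianVarietyProduct
import Literature.AlgebraicGeometry.Motives.Varieties
import Literature.AlgebraicGeometry.HodgeTheory.AlgebraicClassesCupAbelianVariety
import Literature.AlgebraicGeometry.HodgeTheory.HodgeTypePullback
import Literature.AlgebraicGeometry.HodgeTheory.CupPreservesHodgeTypeOfDeRham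
import Literature.AlgebraicGeometry.HodgeTheory.HodgeFiltrationModelsReductionProofs
import Literature.AlgebraicGeometry.HodgeTheory.ComplexConjugationHolds
import Literature.AlgebraicGeometry.Motives.ComplexPointsOrientation
import Literature.NumberTheory.Transcendental.DeRhamTheoremMultiplicative
import HarnessLib

/-!
# WeilClassesDescending

Topic `Literature/AlgebraicGeometry/HodgeTheory`. Named literature fact(s) relocated by the gate from `Summits/HodgeConjecture/HodgeConjecture/Theorems/PadicSemiregularLiftHodgeAbelianVarietiesStubDescend.lean`
(accept-time relocation of `[cite]`d propositions written inline in a Summits proposal; human ruling 2026-08-15).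
Sources: Koike2004WeilHodge, Landherr1936HermitianForms, Markman2025SurveySecant, Schoen1998HodgeWeilAddendum, vanGeemen1994HodgeAV.

* `Literature.AlgebraicGeometry.HodgeTheory.Schoen1998_weilClasses_algebraic_of_prod_surface_all`
* `Literature.AlgebraicGeometry.HodgeTheory.exists_weilTypeSurface_prod_isHyperbolicWeilType_all`

Re-cut 2026-08-16 (D-0026 review of this decomposition of `stub_descend`, Schoen 1998 §10 and Markman
§11.5 Step 2 open): the Weil-type witness of the partner surface `(A₂, φ₂)` carries, in BOTH facts,
Schoen's descent partner — an algebraic class `t ∈ N¹H²(A₂(ℂ); ℂ)` with `u₊ ⌣ t ≠ 0`, `u₋ ⌣ t ≠ 0`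
(p. 333: `A'` is constructed with "`W_{A'}` is generated by cohomology classes of divisors" pairing
onto `H⁴(A')`). The partner fact states its existence (proved for the companion surfaces `E × E`,
`exists_weilType_abelianSurfaces_algebraic`; true for every Weil-type surface by Lefschetz `(1,1)`),
the transfer consumes it and is thereby a THEOREM (`Schoen1998_weilClasses_algebraic_of_prod_surface_all_holds`,
file `WeilClassesDescendingTransfer`); the composite used by
`Summits/…/PadicSemiregularLiftHodgeAbelianVarietiesStubDescend` (`stub_descend_of_partner_of_schoen`)
is unchanged in statement and proof. Proof files: `WeilClassesDescendingProofs` (partner half),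
`WeilClassesDescendingTransfer`, `WeilClassesDescendingOfLefschetzOneOne`.
-/

namespace Literature.AlgebraicGeometry.HodgeTheory

open CategoryTheory
open Literature.AlgebraicGeometry Literature.AlgebraicGeometry.Motives
open Literature.AlgebraicTopology.SingularHomology

/-- **Partner surface with split product, every even dimension (Markman arXiv:2509.23403 §11.5
Step 2, sentences 1–2, with the split criterion of Step 1; van Geemen LNM 1594 Lemma 5.2, 5.3–5.8,
5.4 (5.4.1); Landherr).** For `n ≥ 1`, `d ≥ 1` and a smooth projective complex abelian `2n`-fold
`(A₁, φ₁)` with `φ₁ ≫ φ₁ = -(d • 𝟙 A₁)` whose Weil plane `weilClassesOf A₁ φ₁ n d` contains a NON-ZERO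
rational class of Hodge type `(n,n)` (so `(A₁, K)` is of Weil type `(n,n)`, `K = ℚ(√-d)`: otherwise
`E± = ⋀²ⁿV±` have Hodge types `(p,q) ≠ (n,n)`, van Geemen 5.2 (6)), there exist a smooth projective
complex abelian surface `(A₂, φ₂)` with `φ₂ ≫ φ₂ = -(d • 𝟙 A₂)` OF WEIL TYPE WITH ITS DESCENT
PARTNER — a rational `(1,1)`-class `u₊ + u₋` of its Weil plane with `u₊ ∈ E₊`, `u₋ ∈ E₋` both
non-zero, and an ALGEBRAIC class `t ∈ N¹H²(A₂(ℂ); ℂ) = algebraicClasses A₂.X 1` (a `ℂ`-combination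
of divisor classes) with `u₊ ⌣ t ≠ 0` and `u₋ ⌣ t ≠ 0` in `H⁴(A₂(ℂ); ℂ)` — such that the
product `(A₁ × A₂, φ₁ × φ₂)` of dimension `2(n+1)` is of HYPERBOLIC (= split) Weil type
(`Motives.IsHyperbolicWeilType`, half-dimension `n + 1`) for the `K`-symmetrised hyperplane class
`d · e^*a + (φ₁ × φ₂)^*(e^*a)` of some projective embedding `e` of `A₁ × A₂` and some non-zero
rational `a ∈ H²(ℙᴺ(ℂ); ℂ)`. The descent partner is the datum Schoen CONSTRUCTS together with his
surface `A'` before transferring (§10, proof of the Proposition, p. 333, verbatim: "By 7 there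
exists a Weil pair of rank 2, `(V'_ℤ, ψ')` with invariant `(1, f')`. The choice of an admissible
complex structure `J'` … gives rise to a Weil type Abelian surface `A'`, whose Weil cohomology,
`W_{A'}`, has Hodge type `(1,1)`. `W_{A'}` is generated by cohomology classes of divisors", and
"`ω_{5,σ₁} ∧ ω_{6,σ₁} ∧ ω_{5,σ₂} ∧ ω_{6,σ₂}` is a basis for `H⁴(A'; ℂ)`", i.e. a divisor class
`cl(D) ∈ W_{A'}` pairs non-trivially with both Weil lines); on the tree's carriers it is PROVED for
the companion surfaces `E_i × E_i`, `ψ = ((0,-d),(1,0))`, of every `d`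
(`exists_weilType_abelianSurfaces_algebraic`, file `WeilClassesSurfacesAlgebraic`: the Weil class
`b = u₊ + u₋` is an algebraic divisor class with `b ⌣ b ≠ 0`, whence `u± ⌣ b ≠ 0` by
`cupProduct_weilComponents_ne_zero`), it is the descent pair `η = [Δ_E]` of the sibling typing
`Motives.exists_cmWeilSurface_aimedSplitProduct_of_ne_one_of_ne_three`, and it exists on EVERY
Weil-type surface by Lefschetz's theorem on `(1,1)`-classes (`lefschetzOneOne_rational`) with
`exists_algebraic_partner_of_algebraic` (file `WeilClassesDescendingOfLefschetzOneOne`: `t = u₊ + u₋`).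
Printed proof of the aiming, every sentence of which is stated in every even
dimension: `(A₁, K)` carries a `K`-compatible polarization (`E₊`, van Geemen 5.2 (1)) with a
discriminant `det H ∈ ℚ^×/Nm(K^×)` (5.2 (3)); "The discriminant invariant … is multiplicative under
cartesian products. Every value in `ℚ^×/Nm_{K/ℚ}(K^×)` is realized as the discriminant by some
connected component of moduli in every even dimension" (Markman Step 2; van Geemen 5.3–5.8 with
(5.4.1): `det H = (-1)ⁿ a`, any `a ∈ ℚ_{>0}`), so a Weil surface `A₂` of complementary discriminant
makes `det H_{A₁ × A₂}` the coset of `(-1)ⁿ⁺¹`, and "the discriminant … is the coset of `(-1)ⁿ` if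
and only if the component parametrizes polarized abelian varieties of split Weil type" (Step 1;
Landherr), i.e. hyperbolic; the product polarization `π₁^*h₁ + π₂^*h₂` is `K`-compatible and ample,
hence a positive rational multiple of `d·H + (φ₁ × φ₂)^*H = 2d·H` for the hyperplane class `H` of
the projective embedding defined by a multiple of it (Lefschetz). The tree's `n = 2` fact
`Markman2025_exists_weilTypeSurface_prod_isHyperbolicWeilType` (file `WeilClassesFourfoldsFromSixfolds`)
is the earlier typing WITHOUT the descent partner `t` (re-cut 2026-08-16, D-0026 review of the
decomposition `stub_descend ⇐ this fact + Schoen1998_weilClasses_algebraic_of_prod_surface_all`: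
the conjunct `∃ t, …` was moved from the inside of the transfer — where, for an abstract `A₂`, it
silently amounted to Lefschetz `(1,1)` — to this conclusion, where Schoen prints it; the two facts
compose exactly as before, `Summit.….Stubs.Descend.stub_descend_of_partner_of_schoen`).
[cite: Markman2025SurveySecant, §11.5 Step 1 (last two sentences) and Step 2 (first two sentences)]
[cite: Schoen1998HodgeWeilAddendum, §10 (proof of the Proposition, p. 333, lines 1–4 and the basis of `H⁴(A'; ℂ)`)]
[cite: vanGeemen1994HodgeAV, Lemma 5.2 (1)–(6), 5.3–5.8 and 5.4 (5.4.1)]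
[cite: Landherr1936HermitianForms, main theorem]
[file AlgebraicGeometry/HodgeTheory/WeilClassesDescending] -/
def exists_weilTypeSurface_prod_isHyperbolicWeilType_all : Prop :=
  ∀ (n : ℕ), 0 < n → ∀ (d : ℕ), 0 < d → ∀ (A₁ : Motives.AbelianVariety ℂ) (φ₁ : A₁ ⟶ A₁),
    A₁.dim = 2 * n → Motives.IsSmoothProjective (2 * n) A₁.X → φ₁ ≫ φ₁ = -(d • 𝟙 A₁) →
      (∃ c : complexBetti A₁.X (2 * n), IsRationalClass c ∧
        IsOfHodgeType (2 * n) A₁.X (2 * n) n n c ∧ c ∈ weilClassesOf A₁ φ₁ n d ∧ c ≠ 0) →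
      ∃ (A₂ : Motives.AbelianVariety ℂ) (φ₂ : A₂ ⟶ A₂), A₂.dim = 2 * 1 ∧
        Motives.IsSmoothProjective (2 * 1) A₂.X ∧ φ₂ ≫ φ₂ = -(d • 𝟙 A₂) ∧
        (∃ up um : complexBetti A₂.X (2 * 1), up ∈ weilClassesPlus A₂ φ₂ 1 d ∧
          um ∈ weilClassesMinus A₂ φ₂ 1 d ∧ IsRationalClass (up + um) ∧
          IsOfHodgeType (2 * 1) A₂.X (2 * 1) 1 1 (up + um) ∧ up ≠ 0 ∧ um ≠ 0 ∧
          ∃ t : complexBetti A₂.X (2 * 1), t ∈ algebraicClasses A₂.X 1 ∧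
            cupProduct (show 2 * 1 + 2 * 1 = 2 * (2 * 1) from rfl) up t ≠ 0 ∧
            cupProduct (show 2 * 1 + 2 * 1 = 2 * (2 * 1) from rfl) um t ≠ 0) ∧
        ∃ (e : Motives.ProjectiveEmbedding (A₁.prod A₂).X)
          (a : complexBetti (Motives.projectiveSpace e.n ℂ) 2), IsRationalClass a ∧ a ≠ 0 ∧
          Motives.IsHyperbolicWeilType (A₁.prod A₂)
            (Motives.AbelianVariety.prodLift (Motives.AbelianVariety.fst A₁ A₂ ≫ φ₁)
              (Motives.AbelianVariety.snd A₁ A₂ ≫ φ₂)) (n + 1)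
            ((d : ℂ) • complexBetti.map e.ι 2 a +
              complexBetti.map (Motives.AbelianVariety.prodLift
                (Motives.AbelianVariety.fst A₁ A₂ ≫ φ₁)
                (Motives.AbelianVariety.snd A₁ A₂ ≫ φ₂)).hom.hom.hom 2 (complexBetti.map e.ι 2 a))

/-- **Schoen's transfer, every even dimension (C. Schoen, Compositio Math. 114 (1998), §10
Proposition and its proof, pp. 332–333 — printed for `6 → 4`, `K = ℚ(√-3)`; Koike 2004 Rem. 2.1
for `ℚ(i)`; the "[schoen]" of Markman arXiv:2509.23403 §11.5 Step 2 for all `K`).** For `n ≥ 1`,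
`d ≥ 1`, a smooth projective complex abelian `2n`-fold `(A₁, φ₁)` and a smooth projective complex
abelian surface `(A₂, φ₂)` with `φᵢ ≫ φᵢ = -(d • 𝟙 Aᵢ)`, `A₂` of Weil type with its descent partner
(a rational `(1,1)`-class `u₊ + u₋` of its Weil plane with `u₊ ∈ E₊`, `u₋ ∈ E₋` both non-zero, and
an ALGEBRAIC class `t ∈ N¹H²(A₂(ℂ); ℂ) = algebraicClasses A₂.X 1` with `u₊ ⌣ t ≠ 0`, `u₋ ⌣ t ≠ 0`
in `H⁴(A₂(ℂ); ℂ)` — Schoen's divisor `D`, "`cl(D) ∈ W_{A'}`", "`W_{A'}` is generated by cohomology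
classes of divisors", pairing onto `H⁴(A')`: "Since `ω_{5,σ₁} ∧ ω_{6,σ₁} ∧ ω_{5,σ₂} ∧ ω_{6,σ₂}` is a
basis for `H⁴(A'; ℂ)` the desired surjectivity is clear", p. 333): IF every rational class of Hodge
type `(n+1,n+1)` in the Weil plane of the product `(A₁ × A₂, φ₁ × φ₂)` is algebraic, THEN every
rational class of Hodge type `(n,n)` in the Weil plane `weilClassesOf A₁ φ₁ n d` is algebraic.
Schoen's proof (p. 333: "We claim that `W_A` is generated by cohomology classes of algebraic cycles
of the form `pr_{A*}(z · (A × D))` where `cl(z) ∈ W_{A×A'}` and `cl(D) ∈ W_{A'}`. To check this, it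
is only necessary to show that the cup product in the following diagram is surjective:
`W_{A×A'} ⊗ (H⁰(A) ⊗ W_{A'}) → W_A ⊗ H⁴(A') → W_A`") is dimension-free: for a Weil class
`c = c₊ + c₋` of `A₁` the classes `pr₁^*c± ∪ pr₂^*u±` lie in the Weil lines of the product, hence
are algebraic, and `pr_{1*}((pr₁^*c± ∪ pr₂^*u±) ∪ pr₂^*t) = λ± · c±` with `λ± ≠ 0`. On the tree's
carriers it is PROVED for all `n`, unconditionally, by
`Schoen1998_weilClasses_algebraic_of_prod_surface_all_of_partner` (file
`WeilClassesDescendingTransfer`: rational Weil projector upstairs, translation of divisors on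
`A₁ × A₂`, Gysin push-forward along `pr₁`, fibre integral `≠ 0`; the discharge `…_all_holds` is its
three-line specialisation). Re-cut 2026-08-16 (D-0026 review): the earlier typing omitted `t`, and
for an ABSTRACT Weil-type surface `A₂` its proof then needed Lefschetz's theorem on `(1,1)`-classes
(`lefschetzOneOne_rational`; `Schoen1998_weilClasses_algebraic_of_prod_surface_all_of_lefschetzOneOne`,
file `WeilClassesDescendingOfLefschetzOneOne`, now a historical reduction); Schoen supplies `D`
together with `A'` (first lines of the proof), so the partner fact
`exists_weilTypeSurface_prod_isHyperbolicWeilType_all` now carries `t` and this transfer consumes it.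
The tree's `n = 2` fact `Schoen1998_weilClasses_algebraic_of_prod_surface` (file
`WeilClassesFourfoldsFromSixfolds`) is the earlier typing without `t` at `n = 2`.
[cite: Schoen1998HodgeWeilAddendum, §10 (Proposition and proof, pp. 332–333)]
[cite: Markman2025SurveySecant, §11.5 Step 2] [cite: Koike2004WeilHodge, Remark 2.1]
[file AlgebraicGeometry/HodgeTheory/WeilClassesDescending] -/
def Schoen1998_weilClasses_algebraic_of_prod_surface_all : Prop :=
  ∀ (n : ℕ), 0 < n → ∀ (d : ℕ), 0 < d → ∀ (A₁ : Motives.AbelianVariety ℂ) (φ₁ : A₁ ⟶ A₁)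
    (A₂ : Motives.AbelianVariety ℂ) (φ₂ : A₂ ⟶ A₂), A₁.dim = 2 * n →
    Motives.IsSmoothProjective (2 * n) A₁.X → φ₁ ≫ φ₁ = -(d • 𝟙 A₁) → A₂.dim = 2 * 1 →
    Motives.IsSmoothProjective (2 * 1) A₂.X → φ₂ ≫ φ₂ = -(d • 𝟙 A₂) →
      (∃ up um : complexBetti A₂.X (2 * 1), up ∈ weilClassesPlus A₂ φ₂ 1 d ∧
        um ∈ weilClassesMinus A₂ φ₂ 1 d ∧ IsRationalClass (up + um) ∧
        IsOfHodgeType (2 * 1) A₂.X (2 * 1) 1 1 (up + um) ∧ up ≠ 0 ∧ um ≠ 0 ∧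
        ∃ t : complexBetti A₂.X (2 * 1), t ∈ algebraicClasses A₂.X 1 ∧
          cupProduct (show 2 * 1 + 2 * 1 = 2 * (2 * 1) from rfl) up t ≠ 0 ∧
          cupProduct (show 2 * 1 + 2 * 1 = 2 * (2 * 1) from rfl) um t ≠ 0) →
      (∀ c : complexBetti (A₁.prod A₂).X (2 * (n + 1)), IsRationalClass c →
        IsOfHodgeType (2 * (n + 1)) (A₁.prod A₂).X (2 * (n + 1)) (n + 1) (n + 1) c →
          c ∈ weilClassesOf (A₁.prod A₂)
            (Motives.AbelianVariety.prodLift (Motives.AbelianVariety.fst A₁ A₂ ≫ φ₁)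
              (Motives.AbelianVariety.snd A₁ A₂ ≫ φ₂)) (n + 1) d →
          c ∈ algebraicClasses (A₁.prod A₂).X (n + 1)) →
      ∀ c : complexBetti A₁.X (2 * n), IsRationalClass c →
        IsOfHodgeType (2 * n) A₁.X (2 * n) n n c → c ∈ weilClassesOf A₁ φ₁ n d →
          c ∈ algebraicClasses A₁.X n

end Literature.AlgebraicGeometry.HodgeTheory
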